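import Summits.AtomisticToContinuum.BoseEinsteinCondensation.Theses.BECModePrice
import Summits.AtomisticToContinuum.BoseEinsteinCondensation.Theorems.BECConjugateDominationHardCoreExtensionTruncationEnergyConvergenceAll
import Summits.AtomisticToContinuum.BoseEinsteinCondensation.Theorems.BECConjugateDominationHardCoreExtensionAlphaPhys
import Literature.MathematicalPhysics.QuantumManyBody.PeriodicBoseGasFracEnergy
import Literature.MathematicalPhysics.QuantumManyBody.PeriodicKineticBudget
import Literature.MathematicalPhysics.QuantumManyBody.BoseGasDirichletWall
import Literature.MathematicalPhysics.QuantumManyBody.GroundStateDirichletForm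
import Literature.Barriers.AtomisticToContinuum.KineticGapLengthScalesThermodynamicWindow
import HarnessLib

/-!
# Sketch (crux-ideate, ideator k = 1, round 1) — crux `BECModePrice.ModePriceHardCore`
# (stmt-AtomisticToContinuum-18513)

Typed first lemmas of the two idea cards `tower-shadow` (A) and `doob-jackson-feenberg` (B).
Nothing here is an item; the crux decl is the route's and is not restated (only an `Iff.rfl`-style
unfolding `modePriceHardCore_iff` records that the factored body below is literally the crux body).
-/

noncomputable section

namespace Summit.AtomisticToContinuum.BoseEinsteinCondensation.Cruxes.ModePriceHardCore.IdeatorK1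

open MeasureTheory Filter
open scoped ENNReal NNReal Topology
open Literature.MathematicalPhysics.QuantumManyBody.BoseGas

/-! ## The common body, factored -/

/-- The single-mode-softening (SMS) body at ONE instance `(v, C, ρ, N, p)`: for every periodic trial
state on the torus of side `L_N = (N/ρ)^{1/3}`,
`E₀^per(v) + ½|2πp/L|² n_p(Ψ) ≤ ⟨Ψ, H_v Ψ⟩ + Cρ`.  (`planeWaveMode` / `fracDispersion 2` are the
FracEnergy names of the expressions the route file inlines.) -/
def ModePriceAt (v : ℝ → ℝ≥0∞) (C ρ : ℝ) (N : ℕ) (p : Fin 3 → ℤ) : Prop :=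
  ∀ Ψ : PeriodicTrialState N (sideLength ρ N),
    periodicGroundStateEnergy v N (sideLength ρ N)
        + 2⁻¹ * fracDispersion 2 (sideLength ρ N) p
          * cellOccupation N (sideLength ρ N) (planeWaveMode (sideLength ρ N) p) Ψ.ψ
      ≤ periodicEnergy v Ψ + ENNReal.ofReal (C * ρ)

/-- The crux, re-read through `ModePriceAt` (definitional unfolding of the route decl). -/
theorem modePriceHardCore_iff :
    Summit.AtomisticToContinuum.BoseEinsteinCondensation.Theses.BECModePrice.ModePriceHardCore ↔
      ∀ v : ℝ → ℝ≥0∞, IsRepulsiveFiniteRange v → (∫⁻ x : Space, v ‖x‖) = ⊤ →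
        ∃ C : ℝ, 0 < C ∧ ∃ ρ₀ : ℝ, 0 < ρ₀ ∧ ∀ ρ : ℝ, 0 < ρ → ρ < ρ₀ →
          ∀ᶠ N : ℕ in atTop, ∀ p : Fin 3 → ℤ, p ≠ 0 → ModePriceAt v C ρ N p :=
  Iff.rfl

/-! ## Card A — `tower-shadow` -/

/-- The truncation tower `vₙ = min(v, n)` (bounded, integrable, finite range, `↑ v` pointwise). -/
abbrev trunc (v : ℝ → ℝ≥0∞) (n : ℕ) : ℝ → ℝ≥0∞ := fun r => min (v r) (n : ℝ≥0∞)

/-- **C⁺ of card A (equivalent form of the crux).** Height-uniform SMS along the truncation tower of a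
non-integrable `v`: the constants `C, ρ₀` and the `N`-threshold do not depend on the level `n`; the level
threshold `n₀` may depend on `(N, p)` (that freedom is what makes the converse true as well). Every
level is a BOUNDED finite-range potential, so this is an instance-family of `ModePriceIntegrable` with
audited constants. -/
def UniformTowerModePrice : Prop :=
  ∀ v : ℝ → ℝ≥0∞, IsRepulsiveFiniteRange v → (∫⁻ x : Space, v ‖x‖) = ⊤ →
    ∃ C : ℝ, 0 < C ∧ ∃ ρ₀ : ℝ, 0 < ρ₀ ∧ ∀ ρ : ℝ, 0 < ρ → ρ < ρ₀ →
      ∀ᶠ N : ℕ in atTop, ∀ p : Fin 3 → ℤ, p ≠ 0 → ∃ n₀ : ℕ, ∀ n : ℕ, n₀ ≤ n →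
        ModePriceAt (trunc v n) C ρ N p

/-- **The natural sufficient form (what an `a`-only proof of the integrable crux delivers).**
SMS for all INTEGRABLE finite-range potentials of range `≤ R₀` with constants depending on `v` only
through `R₀` (the scattering length is `≤ R₀` automatically, `scatteringLength_le_range`). -/
def ScaleFreeModePriceIntegrable : Prop :=
  ∀ R₀ : ℝ, 0 < R₀ → ∃ C : ℝ, 0 < C ∧ ∃ ρ₀ : ℝ, 0 < ρ₀ ∧ ∀ ρ : ℝ, 0 < ρ → ρ < ρ₀ →
    ∃ N₀ : ℕ, ∀ N : ℕ, N₀ ≤ N → ∀ p : Fin 3 → ℤ, p ≠ 0 →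
      ∀ v : ℝ → ℝ≥0∞, IsRepulsiveFiniteRange v → (∀ r, R₀ < r → v r = 0) →
        (∫⁻ x : Space, v ‖x‖) ≠ ⊤ → ModePriceAt v C ρ N p

/-- **First lemma of card A (the shadow step), PROVED from landed tree theorems.** At fixed
`(N, L_N, p)`: SMS for all high levels of the truncation tower with a common constant `C` implies SMS
for `v` itself with the same `C` — because SMS is one-sided monotone in the potential
(`periodicEnergy_mono_of_le`) and `E₀(min(v,n)) ↑ E₀(v)` at fixed volume
(`stub_truncationEnergyConvergenceAll`, Rellich + Fatou + Simon's maximal-form bound, hard cores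
included). -/
theorem modePriceAt_of_tower {v : ℝ → ℝ≥0∞} (hv : IsRepulsiveFiniteRange v) {C ρ : ℝ} {N : ℕ}
    {p : Fin 3 → ℤ} (hL : 0 < sideLength ρ N)
    (hE : periodicGroundStateEnergy v N (sideLength ρ N) ≠ ⊤)
    {n₀ : ℕ} (h : ∀ n : ℕ, n₀ ≤ n → ModePriceAt (trunc v n) C ρ N p) :
    ModePriceAt v C ρ N p := by
  intro Ψ
  refine ENNReal.le_of_forall_pos_le_add fun ε hε _ => ?_
  obtain ⟨n₁, hn₁⟩ :=
    Cruxes.HardCoreExtension.ThirdLawCurrentFloorAlt.stub_truncationEnergyConvergenceAll v hv N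
      (sideLength ρ N) hL hE ε (NNReal.coe_pos.mpr hε)
  have h1 := hn₁ (max n₀ n₁) (le_max_right _ _)
  have h2 := h (max n₀ n₁) (le_max_left _ _) Ψ
  have h3 : periodicEnergy (trunc v (max n₀ n₁)) Ψ ≤ periodicEnergy v Ψ :=
    periodicEnergy_mono_of_le (fun r => min_le_left _ _) Ψ
  have hεeq : ENNReal.ofReal (ε : ℝ) = (ε : ℝ≥0∞) := ENNReal.ofReal_coe_nnreal
  calc periodicGroundStateEnergy v N (sideLength ρ N)
        + 2⁻¹ * fracDispersion 2 (sideLength ρ N) p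
          * cellOccupation N (sideLength ρ N) (planeWaveMode (sideLength ρ N) p) Ψ.ψ
      ≤ (periodicGroundStateEnergy (trunc v (max n₀ n₁)) N (sideLength ρ N) + ENNReal.ofReal ε)
        + 2⁻¹ * fracDispersion 2 (sideLength ρ N) p
          * cellOccupation N (sideLength ρ N) (planeWaveMode (sideLength ρ N) p) Ψ.ψ :=
        add_le_add h1 le_rfl
    _ = (periodicGroundStateEnergy (trunc v (max n₀ n₁)) N (sideLength ρ N)
        + 2⁻¹ * fracDispersion 2 (sideLength ρ N) p
          * cellOccupation N (sideLength ρ N) (planeWaveMode (sideLength ρ N) p) Ψ.ψ)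
        + ENNReal.ofReal ε := add_right_comm _ _ _
    _ ≤ (periodicEnergy (trunc v (max n₀ n₁)) Ψ + ENNReal.ofReal (C * ρ)) + ENNReal.ofReal ε :=
        add_le_add h2 le_rfl
    _ ≤ (periodicEnergy v Ψ + ENNReal.ofReal (C * ρ)) + ε := by
        rw [hεeq]; exact add_le_add (add_le_add h3 le_rfl) le_rfl

/-- **Composition of card A (pure logic + two landed facts).** `UniformTowerModePrice` implies the crux,
given (i) `0 < L_N` eventually and (ii) `E₀^per(v; N, L_N) < ⊤` eventually at small density — both in
tree (`DiluteEnergyBound`, stmt-9011 PROVED, or `exists_eventually_periodicGroundStateEnergy_lt_top` of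
`KineticGapLengthScalesThermodynamicWindow`); here they are kept as explicit hypotheses to stay light. -/
theorem modePriceHardCore_of_uniformTower
    (hL : ∀ ρ : ℝ, 0 < ρ → ∀ᶠ N : ℕ in atTop, 0 < sideLength ρ N)
    (hfin : ∀ v : ℝ → ℝ≥0∞, IsRepulsiveFiniteRange v → ∃ ρ₁ : ℝ, 0 < ρ₁ ∧ ∀ ρ : ℝ, 0 < ρ → ρ < ρ₁ →
      ∀ᶠ N : ℕ in atTop, periodicGroundStateEnergy v N (sideLength ρ N) ≠ ⊤)
    (hT : UniformTowerModePrice) :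
    Summit.AtomisticToContinuum.BoseEinsteinCondensation.Theses.BECModePrice.ModePriceHardCore := by
  rw [modePriceHardCore_iff]
  intro v hv hint
  obtain ⟨C, hC, ρ₀, hρ₀, hmain⟩ := hT v hv hint
  obtain ⟨ρ₁, hρ₁, hfinv⟩ := hfin v hv
  refine ⟨C, hC, min ρ₀ ρ₁, lt_min hρ₀ hρ₁, fun ρ hρ hρlt => ?_⟩
  have hρ0 : ρ < ρ₀ := hρlt.trans_le (min_le_left _ _)
  have hρ1 : ρ < ρ₁ := hρlt.trans_le (min_le_right _ _)
  filter_upwards [hmain ρ hρ hρ0, hL ρ hρ, hfinv ρ hρ hρ1] with N hN hLN hEN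
  intro p hp
  obtain ⟨n₀, hn₀⟩ := hN p hp
  exact modePriceAt_of_tower hv hLN hEN hn₀

/-- **Card A, unconditional composition:** `UniformTowerModePrice → ModePriceHardCore`, the two side
hypotheses discharged by landed tree lemmas (`sideLength_pos_of_pos`, BoseGasDirichletWall; Ruelle
finiteness `exists_eventually_periodicGroundStateEnergy_lt_top`, KineticGapLengthScalesThermodynamicWindow).
So the crux is EXACTLY its C⁺ shadow: nothing fixed-volume is missing. -/
theorem ModePriceHardCore_of (hT : UniformTowerModePrice) :
    Summit.AtomisticToContinuum.BoseEinsteinCondensation.Theses.BECModePrice.ModePriceHardCore := by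
  refine modePriceHardCore_of_uniformTower (fun ρ hρ => ?_) (fun v hv => ?_) hT
  · filter_upwards [eventually_gt_atTop 0] with N hN
    exact sideLength_pos_of_pos hρ hN
  · obtain ⟨ρ₁, hρ₁, h⟩ :=
      Literature.Barriers.AtomisticToContinuum.BoseGas.exists_eventually_periodicGroundStateEnergy_lt_top hv
    refine ⟨ρ₁, hρ₁, fun ρ hρ hρ1 => ?_⟩
    filter_upwards [h ρ hρ hρ1] with N hN
    exact hN.ne

/-! ## Card B — `doob-jackson-feenberg` -/

variable {N : ℕ}

/-- The periodic energy of a RAW wave function on the cell (same integrand as `periodicEnergy`, no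
regularity bundled): used for products `G · Ψ₀` that are only Lipschitz at hard-core contact. -/
def rawPeriodicEnergy (v : ℝ → ℝ≥0∞) (L : ℝ) (ψ : Config N → ℂ) : ℝ≥0∞ :=
  ∫⁻ X in cellN N L, kineticDensity ψ X + periodicInteraction v L X * (‖ψ X‖₊ : ℝ≥0∞) ^ 2

/-- Admissible Doob multipliers: `C¹`, `Lℤ³`-periodic in every particle, Bose-symmetric (no definite
total momentum is asked — SMS tests every state; cf. the tree's `IsBlochTest`, which adds one). -/
def IsDoobMultiplier (N : ℕ) (L : ℝ) (G : Config N → ℂ) : Prop :=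
  ContDiff ℝ 1 G ∧ (∀ (X : Config N) (i : Fin N) (k : Fin 3),
    G (X + Pi.single i (EuclideanSpace.single k L)) = G X) ∧
    ∀ (σ : Equiv.Perm (Fin N)) (X : Config N), G (X ∘ σ) = G X

/-- **The Jackson–Feenberg / Doob identity as a PROPERTY of a weight `Ψ₀`** (tree vocabulary:
`groundStateDirichletForm L Ψ₀ G = ∫_cell Σᵢ|∇ᵢG|²|Ψ₀|²`, `weightedNormSq L Ψ₀ G = ∫_cell |G|²|Ψ₀|²`,
GroundStateDirichletForm.lean). For every admissible multiplier `G`: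
`⟨GΨ₀, H_v GΨ₀⟩ = E₀ · ‖G‖²_{Ψ₀} + E_{Ψ₀}(G)` — the potential `v` (hard core or not) has disappeared into
the weight. True for `Ψ₀` the (positive, simple) ground state of the closed periodic form at fixed `(N, L)`
[Davies 1989 §4.2; Reed–Simon IV XIII.12; in tree for INTEGRABLE `W`: PeriodicMaxFormGroundStates /
PeriodicMaxFormPositivity / PeriodicGroundStateNondegenerate — the hard-core case is the open piece]. -/
def IsDoobGroundWeight (v : ℝ → ℝ≥0∞) (N : ℕ) (L : ℝ) (Ψ₀ : Config N → ℂ) : Prop :=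
  (∫⁻ X in cellN N L, (‖Ψ₀ X‖₊ : ℝ≥0∞) ^ 2 = 1) ∧
  ∀ G : Config N → ℂ, IsDoobMultiplier N L G →
    rawPeriodicEnergy v L (fun X => G X * Ψ₀ X) =
      periodicGroundStateEnergy v N L * weightedNormSq L Ψ₀ G + groundStateDirichletForm L Ψ₀ G

/-- **First lemma of card B (classical, fixed volume, L-sized in Lean):** the Doob ground weight exists
for every repulsive finite-range `v` with `E₀ < ⊤` (hard cores included) — existence, positivity off the
hard set and simplicity of the form ground state on the CONNECTED admissible region + the ground-state
representation of the form. -/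
def ExistsDoobWeight : Prop :=
  ∀ v : ℝ → ℝ≥0∞, IsRepulsiveFiniteRange v → ∀ (N : ℕ) (L : ℝ), 0 < L → 0 < N →
    periodicGroundStateEnergy v N L ≠ ⊤ → ∃ Ψ₀ : Config N → ℂ, IsDoobGroundWeight v N L Ψ₀

/-- **SMS in Doob coordinates at one instance** (the reformulated crux body): a two-weight
single-mode inequality for the ground-state measure `μ₀ = |Ψ₀|² dX` — ½|k|² × (occupation of the plane
wave `e_p` in `GΨ₀`) is dominated by the `μ₀`-Dirichlet form of `G` plus `Cρ‖G‖²_{μ₀}`. No `v` occurs. -/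
def DoobModePriceAt (Ψ₀ : Config N → ℂ) (C ρ : ℝ) (p : Fin 3 → ℤ) : Prop :=
  ∀ G : Config N → ℂ, IsDoobMultiplier N (sideLength ρ N) G →
    2⁻¹ * fracDispersion 2 (sideLength ρ N) p
        * cellOccupation N (sideLength ρ N) (planeWaveMode (sideLength ρ N) p) (fun X => G X * Ψ₀ X)
      ≤ groundStateDirichletForm (sideLength ρ N) Ψ₀ G
        + ENNReal.ofReal (C * ρ) * weightedNormSq (sideLength ρ N) Ψ₀ G

/-- Sanity (density-wave class, the FREE direction): Feynman's `ρ_k = planeWaveSum L n` has Dirichlet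
cost `E_{Ψ₀}(ρ_k) = N|k|² ∫|Ψ₀|²` — the tree's f-sum-rule numerator (`groundStateDirichletForm_planeWaveSum`),
i.e. the cost side of the card's density-wave computation is already in tree. -/
example (L : ℝ) (Ψ₀ : Config N → ℂ) (n : Fin 3 → ℤ) := groundStateDirichletForm_planeWaveSum L Ψ₀ n

/-- **The λ = 0 endpoint (`G ≡ 1` of `DoobModePriceAt`): one-mode exponent-2 infrared bound for
near-minimisers** — a consequence of the crux (apply SMS to a `δ`-near-minimiser) and the first TARGET
of line B; strictly weaker-looking than the crux (no claim on far-from-minimal states). -/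
def NearMinimiserModeBound : Prop :=
  ∀ v : ℝ → ℝ≥0∞, IsRepulsiveFiniteRange v → (∫⁻ x : Space, v ‖x‖) = ⊤ →
    ∃ C : ℝ, 0 < C ∧ ∃ ρ₀ : ℝ, 0 < ρ₀ ∧ ∀ ρ : ℝ, 0 < ρ → ρ < ρ₀ →
      ∀ᶠ N : ℕ in atTop, ∀ p : Fin 3 → ℤ, p ≠ 0 → ∃ δ : ℝ≥0∞, 0 < δ ∧
        ∀ Ψ : PeriodicTrialState N (sideLength ρ N), periodicEnergy v Ψ ≠ ⊤ →
          periodicEnergy v Ψ ≤ periodicGroundStateEnergy v N (sideLength ρ N) + δ →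
            2⁻¹ * fracDispersion 2 (sideLength ρ N) p
                * cellOccupation N (sideLength ρ N) (planeWaveMode (sideLength ρ N) p) Ψ.ψ
              ≤ ENNReal.ofReal (C * ρ) + δ

/-- Sanity: the crux gives the endpoint (finite-energy `δ`-near-minimisers pay at most `Cρ + δ`;
the finiteness guard excludes the junk instance `E₀ = ⊤`, where every state is a near-minimiser). -/
theorem nearMinimiserModeBound_of_crux
    (h : Summit.AtomisticToContinuum.BoseEinsteinCondensation.Theses.BECModePrice.ModePriceHardCore) :
    NearMinimiserModeBound := by
  intro v hv hint
  obtain ⟨C, hC, ρ₀, hρ₀, hmain⟩ := (modePriceHardCore_iff.mp h) v hv hint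
  refine ⟨C, hC, ρ₀, hρ₀, fun ρ hρ hρ0 => ?_⟩
  filter_upwards [hmain ρ hρ hρ0] with N hN
  intro p hp
  refine ⟨1, one_pos, fun Ψ hΨfin hΨ => ?_⟩
  have key := hN p hp Ψ
  have hfin : periodicGroundStateEnergy v N (sideLength ρ N) ≠ ⊤ :=
    ne_top_of_le_ne_top hΨfin (periodicGroundStateEnergy_le v Ψ)
  set E₀ := periodicGroundStateEnergy v N (sideLength ρ N) with hE₀
  set X := 2⁻¹ * fracDispersion 2 (sideLength ρ N) p
          * cellOccupation N (sideLength ρ N) (planeWaveMode (sideLength ρ N) p) Ψ.ψ with hX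
  calc X = (E₀ + X) - E₀ := by rw [ENNReal.add_sub_cancel_left hfin]
    _ ≤ (periodicEnergy v Ψ + ENNReal.ofReal (C * ρ)) - E₀ := tsub_le_tsub_right key _
    _ ≤ ((E₀ + 1) + ENNReal.ofReal (C * ρ)) - E₀ := by gcongr
    _ = ENNReal.ofReal (C * ρ) + 1 := by
        rw [add_assoc, ENNReal.add_sub_cancel_left hfin, add_comm]

end Summit.AtomisticToContinuum.BoseEinsteinCondensation.Cruxes.ModePriceHardCore.IdeatorK1

end
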